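import Summits.HubbardSuperconductivity.HubbardSuperconductivity.Theorems.AnisotropyChordTransferFibre3FinXCSound
import Summits.HubbardSuperconductivity.HubbardSuperconductivity.Theorems.AnisotropyChordTransferFibre3Cs2Bound
import Summits.HubbardSuperconductivity.HubbardSuperconductivity.Theorems.AnisotropyChordTransferFibre3NC0Row
import Summits.HubbardSuperconductivity.HubbardSuperconductivity.Theorems.AnisotropyChordTransferFibre3RowCDrops
import Summits.HubbardSuperconductivity.HubbardSuperconductivity.Theorems.AnisotropyChordTransferFibre3GroundExists

/-!
# Route `AnisotropyChord` / H0 rotor rung: FIN small-`L` row-C certificate — `C0(x̂,b)`, the brackets `Chi`, `Nhi`, `T⁺`, and the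
combined cell certificate

Soundness layer 2 of `…Fibre3FinXCEval`: ★ `mem_xcC0x` / `mem_xcRowSum` (p1 `C0Explicit`), ★ `xcObj_sound` (`cs2 ≤ Chi⁺` by p1's
`cs2RealSpaceBound_holds` with `M := xcM/D`, `Γ_M = 2M²(R̄ + 2f_nn²)`, integer square roots; `‖C0′‖² ≤ Nhi⁺` by
`nC0p_le_nC0` + `nC0_split` + `c0FreeBound_holds` + `shell_reduction`; `Tlo ≤ T⁺ ≤ Thi` by `Tplus_bracket` on the row-`N₁`
objects).  The combined cell certificate `xbc_cell_sound` is `…Fibre3FinXCCell`.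
Prover seat `hubbard-h0-rotor-p3` g5; helper for piece A = stmt-HubbardSuperconductivity-23918 of rung 19089 (`--supports`, helper
class).  WHAT THIS IS NOT: nothing here proves superconductivity in the Hubbard model (rotor TARGET as worded stays FALSE, g15 verdict);
two hypotheses (rows `N₁`, C per `L` per cell) of ONE conditional reduction.  Tree imports only; no sorry, no new axioms.
-/

set_option linter.dupNamespace false
set_option autoImplicit false

namespace Summit.HubbardSuperconductivity.HubbardSuperconductivity.Theorems.AnisotropyChord.Transfer.Fibre3

namespace FinXB

open scoped BigOperators
open Finset Hole2 FinCell

variable {L : ℕ} [NeZero L]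

/-! ## `C0(x̂, b)` and the row sum -/

/-- the opposite direction. [folklore] -/
theorem eDir_negDir (j : ℕ) (hj : j < 4) : -eDir L j = eDir L (negDir j) := by
  unfold eDir negDir
  interval_cases j <;> simp

/-- `negDir j < 4`. [folklore] -/
theorem negDir_lt (j : ℕ) : negDir j < 4 := by unfold negDir; split_ifs <;> omega

/-- ★ `C0(x̂, b) ∈ xcC0x` for `b ∉ {0, x̂}` (ground profile; p1's `C0Explicit`). [folklore] -/
theorem mem_xcC0x (hL : 5 ≤ L) {Δ lam2 : ℝ} (hΔ0 : 0 ≤ Δ) (hΔ1 : Δ < 1) {f : Tor L → ℝ} (hf : IsGroundTwoMagnon L Δ lam2 f)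
    {la lb : ℤ} (hla : (la : ℝ) ≤ lam2 * ((D : ℤ) : ℝ)) (hlb : lam2 * ((D : ℤ) : ℝ) ≤ (lb : ℝ))
    (hchk : groundCellCheck L la lb = true) {b1 b2 : ℕ} (h1 : b1 < L) (h2 : b2 < L) (hb : notCore b1 b2 = true) :
    mem (C0fn L Δ lam2 f (ex L, np L b1 b2)) (xcC0x L (fTab4 L la lb) (gTab4 L la lb) b1 b2) := by
  have hL3 : 3 ≤ L := by omega
  have hL0 : 0 < L := by omega
  have hlam : 0 < lam2 := lam2_pos L hL3 hΔ1 hf.1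
  have hfe : f = groundF L lam2 := ground_eq_explicit L (by omega) hΔ0 hΔ1 hf
  have hft : TabEncl L f (fTab4 L la lb) := by rw [hfe]; exact tabEncl_fTab4 (L := L) hL3 hlam hla hlb hchk
  obtain ⟨hb0, hbx⟩ := (notCore_iff (L := L) hL3 h1 h2).mp hb
  have hex : ex L = np L 1 0 := (ex_eq (L := L) hL3).1
  have hexne : ex L ≠ 0 := by
    rw [hex, Ne, np_eq_zero (by omega) hL0]; simp
  have hD' : InD L (ex L, np L b1 b2) = false := by
    unfold InD
    simp only [Bool.or_eq_false_iff, decide_eq_false_iff_not]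
    exact ⟨⟨hexne, hb0⟩, fun h => hbx h.symm⟩
  rw [c0Explicit_holds L Δ lam2 f hf.1 _ hD', nnList_sum_range]
  -- the third site
  have hc : np L b1 b2 - ex L = np L ((b1 + (L - 1)) % L) b2 := by
    rw [hex]; unfold np
    refine Prod.ext ?_ ?_
    · simp only [Prod.fst_sub, ZMod.natCast_mod]
      rw [Nat.cast_add, Nat.cast_sub (by omega : 1 ≤ L), ZMod.natCast_self]; push_cast; ring
    · simp
  have hidx : (b1 + (L - 1)) % L < L := Nat.mod_lt _ hL0
  unfold xcC0x
  have hs := mem_psum (fun j => f (np L b1 b2 - ex L) * Dgrad L f (eDir L j) (ex L) * Dgrad L f (eDir L j) (np L b1 b2)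
      + f (np L b1 b2) * Dgrad L f (-eDir L j) (ex L) * Dgrad L f (eDir L j) (np L b1 b2 - ex L)
      + f (ex L) * Dgrad L f (eDir L j) (np L b1 b2) * Dgrad L f (eDir L j) (np L b1 b2 - ex L)) _ 4 (by
    intro j hj
    rw [eDir_negDir j hj, hc, hex]
    have hg := fun {i : ℕ} (hi : i < 4) {x y : ℕ} (hx : x < L) (hy : y < L) =>
      mem_gradAt (L := L) hL hΔ0 hΔ1 hf hla hlb hchk hi hx hy
    unfold np
    exact mem_iadd (mem_iadd
      (mem_imul (mem_imul (hft _ _ hidx h2) (hg hj (by omega) hL0)) (hg hj h1 h2))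
      (mem_imul (mem_imul (hft _ _ h1 h2) (hg (negDir_lt j) (by omega) hL0)) (hg hj hidx h2)))
      (mem_imul (mem_imul (hft _ _ (by omega) hL0) (hg hj h1 h2)) (hg hj hidx h2)))
  have h := mem_ineg (mem_idivn hs (by norm_num : (0 : ℤ) < 2))
  have e : ∀ x : ℝ, -(x / ((2 : ℤ) : ℝ)) = -(1 / 2) * x := by intro x; push_cast; ring
  rw [e] at h
  simpa only [Prod.mk.eta] using h

/-- ★ `Σ_{b ∉ {0,x̂}} C0(x̂,b)² ∈ xcRowSum`. [folklore] -/
theorem mem_xcRowSum (hL : 5 ≤ L) {Δ lam2 : ℝ} (hΔ0 : 0 ≤ Δ) (hΔ1 : Δ < 1) {f : Tor L → ℝ} (hf : IsGroundTwoMagnon L Δ lam2 f)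
    {la lb : ℤ} (hla : (la : ℝ) ≤ lam2 * ((D : ℤ) : ℝ)) (hlb : lam2 * ((D : ℤ) : ℝ) ≤ (lb : ℝ))
    (hchk : groundCellCheck L la lb = true) :
    mem (∑ b ∈ ((Finset.univ : Finset (Tor L)).erase 0).erase (ex L), C0fn L Δ lam2 f (ex L, b) ^ 2)
      (xcRowSum L (fTab4 L la lb) (gTab4 L la lb)) := by
  classical
  have hL3 : 3 ≤ L := by omega
  have hS : ((Finset.univ : Finset (Tor L)).erase 0).erase (ex L) = Finset.univ.filter (fun b : Tor L => b ≠ 0 ∧ b ≠ ex L) := by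
    ext b; simp [and_comm]
  rw [hS, Finset.sum_filter, sum_tor_range]
  unfold xcRowSum
  refine mem_psum _ _ L fun b1 h1 => mem_psum _ _ L fun b2 h2 => ?_
  have hc := notCore_iff (L := L) hL3 h1 h2
  unfold np at hc
  by_cases hn : notCore b1 b2 = true
  · rw [if_pos (hc.mp hn)]; simp only [hn, if_true]
    exact mem_isqP (mem_xcC0x hL hΔ0 hΔ1 hf hla hlb hchk h1 h2 hn)
  · have : ¬ (((((b1 : ℕ) : ZMod L), ((b2 : ℕ) : ZMod L)) : Tor L) ≠ 0 ∧ ((((b1 : ℕ) : ZMod L), ((b2 : ℕ) : ZMod L)) : Tor L) ≠ ex L) :=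
      fun h => hn (hc.mpr h)
    rw [if_neg this]; simp only [hn]; exact mem_zero


/-! ## The brackets -/

/-- `T⁺ ≥ tPlusLo/D` from the row-`N₁` objects. [folklore] -/
theorem tPlusLo_le {Δ lam2 : ℝ} {f : Tor L → ℝ} {la lb : ℤ} (H : CellHyp (L := L) Δ lam2 f la lb)
    (hP : 0 < (xbEval L la lb).2.P.1) :
    ((tPlusLo (xbEval L la lb).1 (xbEval L la lb).2 : ℤ) : ℝ) ≤ Tplus L Δ f * ((D : ℤ) : ℝ) := by
  have hD := D_pos
  set S := (xbEval L la lb).1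
  set O := (xbEval L la lb).2
  have mP := H.mem_objP; have mQ := H.mem_objQ
  have mlam : mem lam2 S.lam := H.hS.1
  have hPlo : 0 < (O.P.1 : ℝ) / ((D : ℤ) : ℝ) := by
    have : (0 : ℝ) < (O.P.1 : ℝ) := by exact_mod_cast hP
    positivity
  have hP2pos : 0 < O.P.2 := by
    have : (O.P.1 : ℝ) ≤ (O.P.2 : ℝ) := mP.1.trans mP.2
    have : O.P.1 ≤ O.P.2 := by exact_mod_cast this
    omega
  have hP1 : (O.P.1 : ℝ) / ((D : ℤ) : ℝ) ≤ PiNormSq L f := by rw [div_le_iff₀ hD]; exact mP.1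
  have hP2 : PiNormSq L f ≤ (O.P.2 : ℝ) / ((D : ℤ) : ℝ) := by rw [le_div_iff₀ hD]; exact mP.2
  have hQ1 : (O.Q.1 : ℝ) / ((D : ℤ) : ℝ) ≤ ∑ c : Cfg L, piR L f c * C0fn L Δ lam2 f c := by rw [div_le_iff₀ hD]; exact mQ.1
  have hQ2 : ∑ c : Cfg L, piR L f c * C0fn L Δ lam2 f c ≤ (O.Q.2 : ℝ) / ((D : ℤ) : ℝ) := by rw [le_div_iff₀ hD]; exact mQ.2
  have hT := (KT1Assembly.Tplus_bracket L H.hf.1 hPlo hP1 hP2 hQ1 hQ2).1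
  have u1 := (mem_iscale 3 mlam).1
  have u2 := (mem_imul (mem_ipt O.Q.1) (mem_iinv (mem_ipt O.P.1) (by exact hP))).1
  have u3 := (mem_imul (mem_ipt O.Q.1) (mem_iinv (mem_ipt O.P.2) (by exact hP2pos))).1
  unfold tPlusLo
  push_cast
  push_cast at u1 u2 u3
  rw [← div_eq_mul_one_div] at u2 u3
  have hmin : min (((imul (ipt O.Q.1) (iinv (ipt O.P.1))).1 : ℤ) : ℝ) (((imul (ipt O.Q.1) (iinv (ipt O.P.2))).1 : ℤ) : ℝ)
      ≤ min ((O.Q.1 : ℝ) / ((D : ℤ) : ℝ) / ((O.P.1 : ℝ) / ((D : ℤ) : ℝ)))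
            ((O.Q.1 : ℝ) / ((D : ℤ) : ℝ) / ((O.P.2 : ℝ) / ((D : ℤ) : ℝ))) * ((D : ℤ) : ℝ) := by
    rw [min_mul_of_nonneg _ _ hD.le]
    exact min_le_min u2 u3
  nlinarith [hmin, u1, hT]

/-- `T⁺ ≤ tPlusHi/D` from the row-`N₁` objects. [folklore] -/
theorem le_tPlusHi {Δ lam2 : ℝ} {f : Tor L → ℝ} {la lb : ℤ} (H : CellHyp (L := L) Δ lam2 f la lb)
    (hP : 0 < (xbEval L la lb).2.P.1) :
    Tplus L Δ f * ((D : ℤ) : ℝ) ≤ ((tPlusHi (xbEval L la lb).1 (xbEval L la lb).2 : ℤ) : ℝ) := by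
  have hD := D_pos
  set S := (xbEval L la lb).1
  set O := (xbEval L la lb).2
  have mP := H.mem_objP; have mQ := H.mem_objQ
  have mlam : mem lam2 S.lam := H.hS.1
  have hPlo : 0 < (O.P.1 : ℝ) / ((D : ℤ) : ℝ) := by
    have : (0 : ℝ) < (O.P.1 : ℝ) := by exact_mod_cast hP
    positivity
  have hP2pos : 0 < O.P.2 := by
    have : (O.P.1 : ℝ) ≤ (O.P.2 : ℝ) := mP.1.trans mP.2
    have : O.P.1 ≤ O.P.2 := by exact_mod_cast this
    omega
  have hP1 : (O.P.1 : ℝ) / ((D : ℤ) : ℝ) ≤ PiNormSq L f := by rw [div_le_iff₀ hD]; exact mP.1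
  have hP2 : PiNormSq L f ≤ (O.P.2 : ℝ) / ((D : ℤ) : ℝ) := by rw [le_div_iff₀ hD]; exact mP.2
  have hQ1 : (O.Q.1 : ℝ) / ((D : ℤ) : ℝ) ≤ ∑ c : Cfg L, piR L f c * C0fn L Δ lam2 f c := by rw [div_le_iff₀ hD]; exact mQ.1
  have hQ2 : ∑ c : Cfg L, piR L f c * C0fn L Δ lam2 f c ≤ (O.Q.2 : ℝ) / ((D : ℤ) : ℝ) := by rw [le_div_iff₀ hD]; exact mQ.2
  have hT := (KT1Assembly.Tplus_bracket L H.hf.1 hPlo hP1 hP2 hQ1 hQ2).2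
  have u1 := (mem_iscale 3 mlam).2
  have u2 := (mem_imul (mem_ipt O.Q.2) (mem_iinv (mem_ipt O.P.1) (by exact hP))).2
  have u3 := (mem_imul (mem_ipt O.Q.2) (mem_iinv (mem_ipt O.P.2) (by exact hP2pos))).2
  unfold tPlusHi
  push_cast
  push_cast at u1 u2 u3
  rw [← div_eq_mul_one_div] at u2 u3
  have hmax : max ((O.Q.2 : ℝ) / ((D : ℤ) : ℝ) / ((O.P.1 : ℝ) / ((D : ℤ) : ℝ)))
        ((O.Q.2 : ℝ) / ((D : ℤ) : ℝ) / ((O.P.2 : ℝ) / ((D : ℤ) : ℝ))) * ((D : ℤ) : ℝ)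
      ≤ max (((imul (ipt O.Q.2) (iinv (ipt O.P.1))).2 : ℤ) : ℝ) (((imul (ipt O.Q.2) (iinv (ipt O.P.2))).2 : ℤ) : ℝ) := by
    rw [max_mul_of_nonneg _ _ hD.le]
    exact max_le_max u2 u3
  nlinarith [hmax, u1, hT]

/-- ★ the row-C objects: reals `Chi ≥ cs2`, `Nhi ≥ ‖C0′‖²` enclosed by `C.chi`, `C.nhi`, and `η ∈ C.eta`. [folklore] -/
theorem xcObj_sound {Δ lam2 : ℝ} {f : Tor L → ℝ} {la lb : ℤ} (H : CellHyp (L := L) Δ lam2 f la lb)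
    (hMok : xcMok L (fTab4 L la lb) (xcObj L la lb (xbEval L la lb).1 (xbEval L la lb).2).M = true) :
    ∃ Chi Nhi : ℝ, cs2 L f ≤ Chi ∧ nC0p L Δ f ≤ Nhi ∧ 0 ≤ Chi ∧ 0 ≤ Nhi ∧
      mem Chi (xcObj L la lb (xbEval L la lb).1 (xbEval L la lb).2).chi ∧
      mem Nhi (xcObj L la lb (xbEval L la lb).1 (xbEval L la lb).2).nhi ∧
      mem (etaEff L lam2) (xcObj L la lb (xbEval L la lb).1 (xbEval L la lb).2).eta := by
  have hL := H.hL
  have hL3 : 3 ≤ L := H.hL3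
  have hD := D_pos
  have hlam := H.hlam
  have hf := H.hf
  have hev := H.hev
  have hfe : f = groundF L lam2 := ground_eq_explicit L (by omega) H.hΔ0 H.hΔ1 hf
  have hsw : ∀ r : Tor L, f (r.2, r.1) = f r := fun r => by rw [hfe]; exact groundF_swap lam2 r
  have hmi : ∀ r : Tor L, f (-r.1, r.2) = f r := ground_mirror L (by omega) hf
  have hft : TabEncl L f (fTab4 L la lb) := by rw [hfe]; exact tabEncl_fTab4 (L := L) hL3 hlam H.hla H.hlb H.hchk
  have hgx : ∀ r1 r2 : ℕ, r1 < L → r2 < L → mem (Dgrad L f (ex L) (np L r1 r2)) (getF (gTab4 L la lb) r1 r2) := by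
    intro r1 r2 h1 h2
    have := mem_gradAt (L := L) hL H.hΔ0 H.hΔ1 hf H.hla H.hlb H.hchk (show 0 < 4 by norm_num) h1 h2
    simpa [gradAt, eDir] using this
  set S := (xbEval L la lb).1 with hSdef
  set O := (xbEval L la lb).2 with hOdef
  have mlam : mem lam2 S.lam := H.hS.1
  have meps : mem (eps1 L) S.eps1 := H.hS.2.2.2.2.2.2.2.2.2.2
  set Mz := xcM L (fTab4 L la lb) with hMz
  set M : ℝ := (Mz : ℝ) / ((D : ℤ) : ℝ) with hM
  have hMabs : ∀ r : Tor L, |f r| ≤ M := abs_le_of_xcMok hft hMok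
  have mM : mem M (ipt Mz) := mem_ipt Mz
  have mQ0 := mem_xcQ0 (L := L) hft
  have mRb := mem_xcRbar (L := L) hL3 (Δ := Δ) (f := f) hgx
  have mX := mem_xcX (L := L) hL3 (Δ := Δ) (f := f) hgx
  have mPsi := mem_xcPsi (L := L) hL H.hΔ0 H.hΔ1 hf H.hla H.hlb H.hchk
  have mRS := mem_xcRowSum (L := L) hL H.hΔ0 H.hΔ1 hf H.hla H.hlb H.hchk
  have hL0 : 0 < L := by omega
  have mfnn : mem (f (K1 L)) (getF (fTab4 L la lb) 1 0) := by
    have := hft 1 0 (by omega) hL0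
    have e : K1 L = ((((1 : ℕ) : ZMod L)), (((0 : ℕ) : ZMod L))) := by unfold K1; simp
    rw [e]; exact this
  have mfnn2 := mem_isqP mfnn
  have mM2 := mem_imul mM mM
  rw [← sq] at mM2
  have mGam : mem (GammaM L Δ f M) (iscale 2 (imul (imul (ipt Mz) (ipt Mz)) (iadd (xcRbar L (gTab4 L la lb))
      (iscale 2 (isqP (getF (fTab4 L la lb) 1 0)))))) := by
    unfold GammaM
    have h := mem_iscale 2 (mem_imul mM2 (mem_iadd mRb (by have := mem_iscale 2 mfnn2; push_cast at this; exact this)))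
    push_cast at h
    have e : (2 : ℝ) * (M ^ 2 * (Rbar L Δ f + 2 * f (K1 L) ^ 2)) = 2 * M ^ 2 * (Rbar L Δ f + 2 * f (K1 L) ^ 2) := by ring
    rwa [e] at h
  have hQ0nn : 0 ≤ Q0 L f := Finset.sum_nonneg fun r _ => by positivity
  have hRwt : ∀ a, 0 ≤ Rwt L Δ f a := by
    intro a; unfold Rwt
    by_cases h : a = 0 ∨ a = K1 L
    · rw [if_pos h]
    · rw [if_neg h]; exact sq_nonneg _
  have hRbnn : 0 ≤ Rbar L Δ f := Finset.sum_nonneg fun a _ => hRwt a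
  have hXnn : 0 ≤ Xmom L Δ f := Finset.sum_nonneg fun a _ =>
    mul_nonneg (hRwt a) (sub_nonneg.mpr (Real.cos_le_one _))
  have hMnn : 0 ≤ M := le_trans (abs_nonneg _) (hMabs 0)
  have hGnn : 0 ≤ GammaM L Δ f M := by
    unfold GammaM
    exact mul_nonneg (mul_nonneg (by norm_num) (sq_nonneg _)) (add_nonneg hRbnn (mul_nonneg (by norm_num) (sq_nonneg _)))
  have hrad : 0 ≤ 4 * Q0 L f * Xmom L Δ f * (GammaM L Δ f M * Rbar L Δ f) :=
    mul_nonneg (mul_nonneg (mul_nonneg (by norm_num) hQ0nn) hXnn) (mul_nonneg hGnn hRbnn)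
  have mrad := mem_imul (mem_iscale 4 (mem_imul mQ0 mX)) (mem_imul mGam mRb)
  have msq : mem (Real.sqrt (4 * Q0 L f * Xmom L Δ f * (GammaM L Δ f M * Rbar L Δ f)))
      (isqrt (imul (iscale 4 (imul (xcQ0 L (fTab4 L la lb)) (xcX L (gTab4 L la lb) (cosTab L))))
        (imul (iscale 2 (imul (imul (ipt Mz) (ipt Mz)) (iadd (xcRbar L (gTab4 L la lb))
          (iscale 2 (isqP (getF (fTab4 L la lb) 1 0)))))) (xcRbar L (gTab4 L la lb))))) := by
    refine mem_isqrt (Real.sqrt_nonneg _) ?_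
    rw [Real.sq_sqrt hrad]
    push_cast at mrad
    have e : ((4 : ℕ) : ℝ) * (Q0 L f * Xmom L Δ f) * (GammaM L Δ f M * Rbar L Δ f)
        = 4 * Q0 L f * Xmom L Δ f * (GammaM L Δ f M * Rbar L Δ f) := by push_cast; ring
    rw [← e]; exact_mod_cast mrad
  have hcs := cs2RealSpaceBound_holds L Δ lam2 M f hf.1 hmi hMabs
  have mChi := mem_iadd (mem_iadd (mem_iscale 4 (mem_imul (mem_imul meps mQ0) mX))
    (mem_imul (mem_imul meps mRb) (mem_iadd mGam (mem_iscale 2 (mem_imul mfnn2 mM2)))))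
    (mem_iscale 2 (mem_imul meps msq))
  have h1 := ShellRow.nC0p_le_nC0 L hf.1
  have h2 := ShellRow.nC0_split L Δ lam2 f
  have h3 := c0FreeBound_holds L Δ lam2 M f hf.1 hev hMabs
  have h4 := ShellRow.shell_reduction L Δ lam2 hev hsw
  have eSh : nC0shell L Δ lam2 f = ∑ c ∈ Finset.univ.filter (fun c : Cfg L => Wcount L c ≠ 0), C0fn L Δ lam2 f c ^ 2 := rfl
  rw [← eSh] at h2
  have mN := mem_iadd (mem_idivn (mem_iscale 9 (mem_imul mM2 mPsi)) (by norm_num : (0:ℤ) < 4)) (mem_iscale 12 mRS)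
  have hcs0 : 0 ≤ cs2 L f := by
    unfold cs2
    exact Finset.sum_nonneg fun c _ => by
      split_ifs
      · exact le_rfl
      · exact div_nonneg (add_nonneg (mul_nonneg (sq_nonneg _) (Complex.normSq_nonneg _))
          (mul_nonneg (sq_nonneg _) (Complex.normSq_nonneg _))) (by norm_num)
  have hn0 : 0 ≤ nC0p L Δ f := by unfold nC0p; exact Finset.sum_nonneg fun c _ => Complex.normSq_nonneg _
  have hNle : nC0p L Δ f ≤ 9 / 4 * M ^ 2 * PsiSum L Δ f
      + 12 * ∑ b ∈ ((Finset.univ : Finset (Tor L)).erase 0).erase (ex L), C0fn L Δ lam2 f (ex L, b) ^ 2 := by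
    linarith [h1, h2, h3, h4]
  refine ⟨_, _, hcs, hNle, hcs0.trans hcs, hn0.trans hNle, ?_, ?_, ?_⟩
  · have e : ((4 : ℕ) : ℝ) * (eps1 L * Q0 L f * Xmom L Δ f)
          + eps1 L * Rbar L Δ f * (GammaM L Δ f M + ((2 : ℕ) : ℝ) * (f (K1 L) ^ 2 * M ^ 2))
          + ((2 : ℕ) : ℝ) * (eps1 L * Real.sqrt (4 * Q0 L f * Xmom L Δ f * (GammaM L Δ f M * Rbar L Δ f)))
        = 4 * eps1 L * Q0 L f * Xmom L Δ f + eps1 L * Rbar L Δ f * (GammaM L Δ f M + 2 * f (K1 L) ^ 2 * M ^ 2)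
          + 2 * eps1 L * Real.sqrt (4 * Q0 L f * Xmom L Δ f * (GammaM L Δ f M * Rbar L Δ f)) := by push_cast; ring
    rw [e] at mChi
    unfold xcObj
    exact mChi
  · have e : ((9 : ℕ) : ℝ) * (M ^ 2 * PsiSum L Δ f) / ((4 : ℤ) : ℝ)
          + ((12 : ℕ) : ℝ) * ∑ b ∈ ((Finset.univ : Finset (Tor L)).erase 0).erase (ex L), C0fn L Δ lam2 f (ex L, b) ^ 2
        = 9 / 4 * M ^ 2 * PsiSum L Δ f
          + 12 * ∑ b ∈ ((Finset.univ : Finset (Tor L)).erase 0).erase (ex L), C0fn L Δ lam2 f (ex L, b) ^ 2 := by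
      push_cast; ring
    rw [e] at mN
    unfold xcObj
    exact mN
  · unfold xcObj etaEff
    have hVl : mem ((L : ℝ) ^ 2 * lam2) (iscale (L * L) S.lam) := by
      have := mem_iscale (L * L) mlam; push_cast at this; rw [← sq] at this; exact this
    have h := mem_idivn hVl (by norm_num : (0:ℤ) < 4)
    have e : (L : ℝ) ^ 2 * lam2 / ((4 : ℤ) : ℝ) = (L : ℝ) ^ 2 * lam2 / 4 := by push_cast; ring
    rwa [e] at h

end FinXB

end Summit.HubbardSuperconductivity.HubbardSuperconductivity.Theorems.AnisotropyChord.Transfer.Fibre3
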